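import Summits.AtomisticToContinuum.FouriersLaw.Theses.HoelderEscapeProfile

/-!
# `CornerNoDip` (crux stmt-AtomisticToContinuum-16009, route `HoelderEscapeProfile`):
# the dynamical binding `G = ∫ j₀ (jₓ ∘ φ_t) dμ` is load-bearing — the analytic shell is FALSE
# (negative-side support, refuter crux-attack seat)

`CornerNoDip` says: in the guarded infinite-volume frame `(μ_T, D)` of the pinned anharmonic chain,
with `G x t = ∫ j_0 σ · j_x (φ_t σ) dμ` and `Gh ν k = ∫₀^∞ e^{-νt} Σ_x cos(kx) G x t dt` junk-free, for
every `a, ε > 0` eventually in `ν` one has `Gh ν k ≤ Gh ν 0 + ε` on the parabolic window `|k| ≤ a√ν`.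

Here we record, sorry-free, that the two ANALYTIC guards of the crux (absolute summability of
`x ↦ G x t` at every `t` — the content of `HasAbsConvergentCorrelation` — and integrability of the
Abel integrand on `(0, ∞)`) do NOT imply the conclusion for an arbitrary kernel `G : ℤ → ℝ → ℝ`:

* `cornerNoDip_false_without_dynamics` — the crux with the `(μ, D)` frame and the binding of `G`
  deleted (everything else verbatim) is false.  Witness: the FROZEN NEGATIVE NEAREST-NEIGHBOUR
  KERNEL `G x t = -[x = 1]` (time-independent: a negative "Drude atom" of the bond-current
  correlation at separation `1`).  Then `Σ_x cos(kx) G x t = -cos k`, `Gh ν k = -cos k / ν`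
  (`abel_frozenKernel`), and along `k = π√ν` (inside the window for `a = π`)
  `Gh ν k − Gh ν 0 = (1 − cos(π√ν))/ν ≥ 2 > 1 = ε`, by `cos y ≤ 1 − 2y²/π²` on `|y| ≤ π`.

Reading for provers.  A proof of `CornerNoDip` must use a DYNAMICAL property of the true current
kernel that kills exactly this witness: decay IN ABEL MEAN of the fixed-separation current
correlation, `ν · G_ν(x) → 0` for each fixed `x` (no Drude-type atom at a fixed separation — what
mixing of `(μ_T, φ_t)` would give; nothing in tree proves it).  The static sign obstruction named in
the crux docstring (`G_ν(±1) < 0`, from `Cov(V'(r_0), V'(r_1)) < 0`) is harmless only because it is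
`O(1)` as `ν → 0`, not `O(1/ν)` as here.
-/

noncomputable section

namespace Summit.AtomisticToContinuum.FouriersLaw.Theorems.CornerNoDip.Negative

open MeasureTheory Set Filter

/-! The frozen negative nearest-neighbour kernel is written inline as `fun x : ℤ => if x = 1 then -1 else 0`
(no auxiliary definition, so that this file stays a pure-proof proposal). -/

/-- Its cosine series is `-cos k`. [folklore] -/
theorem tsum_cos_frozenKernel (k : ℝ) :
    (∑' x : ℤ, Real.cos (k * (x : ℝ)) * (if x = (1 : ℤ) then (-1 : ℝ) else 0)) = -Real.cos k := by
  rw [tsum_eq_single 1]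
  · simp
  · intro x hx
    simp [hx]

/-- It is absolutely summable (finite support). [folklore] -/
theorem summable_abs_frozenKernel : Summable fun x : ℤ => |(if x = (1 : ℤ) then (-1 : ℝ) else 0)| := by
  refine summable_of_ne_finset_zero (s := {1}) (fun x hx => ?_)
  simp only [Finset.mem_singleton] at hx
  simp [hx]

/-- `∫₀^∞ e^{-νt} dt = 1/ν` for `ν > 0`. [folklore] -/
theorem integral_exp_neg_mul_Ioi_zero {ν : ℝ} (hν : 0 < ν) :
    ∫ t in Set.Ioi (0:ℝ), Real.exp (-(ν * t)) = 1 / ν := by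
  have h := integral_exp_mul_Ioi (a := -ν) (by linarith) 0
  simp only [neg_mul, mul_zero, Real.exp_zero] at h
  rw [h]
  field_simp

/-- The Abel transform of the frozen kernel: `Gh ν k = -cos k / ν`. [folklore] -/
theorem abel_frozenKernel {ν : ℝ} (hν : 0 < ν) (k : ℝ) :
    (∫ t in Set.Ioi (0:ℝ), Real.exp (-(ν * t)) *
        ∑' x : ℤ, Real.cos (k * (x : ℝ)) * (if x = (1 : ℤ) then (-1 : ℝ) else 0)) = -Real.cos k / ν := by
  simp_rw [tsum_cos_frozenKernel, integral_mul_const, integral_exp_neg_mul_Ioi_zero hν]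
  field_simp

/-- The Abel integrand of the frozen kernel is integrable on `(0, ∞)` (the crux's guard holds).
[folklore] -/
theorem integrableOn_abel_frozenKernel {ν : ℝ} (hν : 0 < ν) (k : ℝ) :
    IntegrableOn (fun t : ℝ => Real.exp (-(ν * t)) *
      ∑' x : ℤ, Real.cos (k * (x : ℝ)) * (if x = (1 : ℤ) then (-1 : ℝ) else 0)) (Set.Ioi 0) := by
  simp_rw [tsum_cos_frozenKernel]
  have h1 := exp_neg_integrableOn_Ioi 0 hν
  simp only [neg_mul] at h1
  exact h1.integrable.mul_const _

/-- **`CornerNoDip` without the dynamical binding is false.**  The proposition negated is the crux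
`HoelderEscapeProfile.CornerNoDip` with the `(μ, D)` frame and `G = fun x t => ∫ j_0 · (j_x ∘ φ_t) dμ`
deleted, `G` arbitrary, the guard `∀ t, HasAbsConvergentCorrelation μ t` replaced by its content
`∀ t, Summable (|G · t|)`, and everything else (the definition of `Gh`, the integrability guard, the
`∀ a ε ∃ ν₀ ∀ ν k` conclusion) verbatim.  Witness: `frozenKernel`, `a = π`, `ε = 1`,
`ν = min ν₀ 1`, `k = π√ν`. [folklore] -/
theorem cornerNoDip_false_without_dynamics :
    ¬ (∀ G : ℤ → ℝ → ℝ, ∀ Gh : ℝ → ℝ → ℝ,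
        Gh = (fun (ν k : ℝ) => ∫ t in Set.Ioi (0:ℝ),
          Real.exp (-(ν * t)) * ∑' x : ℤ, Real.cos (k * (x : ℝ)) * G x t) →
        (∀ t : ℝ, Summable fun x : ℤ => |G x t|) →
        (∀ ν : ℝ, 0 < ν → ∀ k : ℝ, IntegrableOn (fun t : ℝ =>
          Real.exp (-(ν * t)) * ∑' x : ℤ, Real.cos (k * (x : ℝ)) * G x t) (Set.Ioi 0)) →
        ∀ a : ℝ, 0 < a → ∀ ε : ℝ, 0 < ε → ∃ ν₀ : ℝ, 0 < ν₀ ∧ ∀ ν : ℝ, 0 < ν → ν ≤ ν₀ →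
          ∀ k : ℝ, |k| ≤ a * Real.sqrt ν → Gh ν k ≤ Gh ν 0 + ε) := by
  intro h
  obtain ⟨ν₀, hν₀, H⟩ := h (fun x _ => if x = (1 : ℤ) then (-1 : ℝ) else 0) _ rfl (fun _ => summable_abs_frozenKernel)
    (fun ν hν k => integrableOn_abel_frozenKernel hν k) Real.pi Real.pi_pos 1 one_pos
  set ν : ℝ := min ν₀ 1 with hνdef
  have hν : 0 < ν := lt_min hν₀ one_pos
  have hν1 : ν ≤ 1 := min_le_right _ _
  set k : ℝ := Real.pi * Real.sqrt ν with hkdef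
  have hk0 : 0 ≤ k := by positivity
  have hkwin : |k| ≤ Real.pi * Real.sqrt ν := by rw [abs_of_nonneg hk0]
  have H' := H ν hν (min_le_left _ _) k hkwin
  beta_reduce at H'
  rw [abel_frozenKernel hν k, abel_frozenKernel hν 0, Real.cos_zero] at H'
  -- `H' : -cos k / ν ≤ -1 / ν + 1`
  have key : -Real.cos k ≤ (-1 / ν + 1) * ν := (div_le_iff₀ hν).mp H'
  have e1 : (-1 / ν + 1) * ν = ν - 1 := by
    field_simp
    ring
  rw [e1] at key
  have hkπ : |k| ≤ Real.pi := by
    rw [abs_of_nonneg hk0, hkdef]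
    have hs : Real.sqrt ν ≤ 1 := Real.sqrt_le_one.mpr hν1
    nlinarith [Real.pi_pos]
  have hcos := Real.cos_le_one_sub_mul_cos_sq hkπ
  have hk2 : k ^ 2 = Real.pi ^ 2 * ν := by rw [hkdef, mul_pow, Real.sq_sqrt hν.le]
  rw [hk2] at hcos
  have e2 : 2 / Real.pi ^ 2 * (Real.pi ^ 2 * ν) = 2 * ν := by
    field_simp
  linarith

end Summit.AtomisticToContinuum.FouriersLaw.Theorems.CornerNoDip.Negative

end
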